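import Mathlib.Analysis.SpecialFunctions.Pow.Real
import Mathlib.Analysis.Complex.Polynomial.Basic
import Mathlib.Analysis.SpecificLimits.Normed
import HarnessLib

/-!
# Quantitative deflation for a real second-order linear recurrence

For a real sequence with `w_{n+2} = −p·w_{n+1} − κ·w_n` and a bound `R` on the moduli of the (complex) roots of the characteristic
polynomial `σ² + pσ + κ`, the EXPLICIT estimate
`|w_{n+1}| ≤ R^{n+1}|w₀| + (n+1)·Rⁿ·(|w₁| + R|w₀|)`
(complex deflation: `g_n = W_{n+1} − σ₁W_n` satisfies `g_{n+1} = σ₂ g_n`; no case distinction at a double root).  This is the quantitative form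
of the tree's `tendsto_zero_of_rec_two_schurCohn` (`…FugacityWidthOneParityAmplitude`), stated so that the constants are explicit — the input
needed for UNIFORM (in a parameter) geometric remainder bounds of coefficient asymptotics of rational generating functions (lane «pcv-sawmu»,
DOOR-ap5-g24 item 1: uniform two-term asymptotics of the strip partition function).
* §1 `abs_le_of_rec_two` (the bound); `tendsto_zero_of_rec_two_of_lt_one` (`R < 1 ⇒ w_n → 0`, recovered);
* §2 `abs_sub_le_of_rec_two_shift` — the same for `w_n − L` when `w` satisfies the recurrence up to a constant (`w_{n+2} + p w_{n+1} + κ w_n = c`,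
  `1 + p + κ ≠ 0`, `L = c/(1+p+κ)`).

## Sources
Stanley2012EC1 §4.1 Theorem 4.1.1 (iii) (coefficient asymptotics of rational functions: the poles of smallest modulus dominate, with polynomial
factors at multiple poles); lane arrangement (complex deflation) as in the tree's parity-amplitude file.  Nothing quoted AS PRINTED.
-/

noncomputable section

open Filter Topology

namespace Literature.Analysis

/-! ## §1 The deflation bound -/

/-- ★★ **Quantitative deflation**: if every complex root `σ` of `σ² + pσ + κ` has `‖σ‖ ≤ R` (`R ≥ 0`) and the real sequence `w` satisfies
`w_{n+2} = −p w_{n+1} − κ w_n`, then `|w_{n+1}| ≤ R^{n+1}|w₀| + (n+1) Rⁿ (|w₁| + R|w₀|)` for every `n`.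
[cite: Stanley2012EC1, §4.1 Theorem 4.1.1 (iii) (lane statement, explicit constants)] -/
theorem abs_le_of_rec_two {p κ R : ℝ} (hR0 : 0 ≤ R) (hR : ∀ σ : ℂ, σ ^ 2 + p * σ + κ = 0 → ‖σ‖ ≤ R) {w : ℕ → ℝ}
    (hw : ∀ n, w (n + 2) = -p * w (n + 1) - κ * w n) (n : ℕ) :
    |w (n + 1)| ≤ R ^ (n + 1) * |w 0| + ((n : ℝ) + 1) * R ^ n * (|w 1| + R * |w 0|) := by
  obtain ⟨c, hc⟩ := IsAlgClosed.exists_pow_nat_eq ((p : ℂ) ^ 2 - 4 * (κ : ℂ)) (by norm_num : 0 < 2)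
  set σ₁ : ℂ := (-p + c) / 2 with hσ₁
  set σ₂ : ℂ := (-p - c) / 2 with hσ₂
  have hsum : σ₂ = -p - σ₁ := by rw [hσ₁, hσ₂]; ring
  have hprod : σ₁ * σ₂ = κ := by
    rw [hσ₁, hσ₂]; linear_combination (-1 / 4 : ℂ) * hc
  have hq1 : σ₁ ^ 2 + p * σ₁ + κ = 0 := by rw [← hprod, hsum]; ring
  have hq2 : σ₂ ^ 2 + p * σ₂ + κ = 0 := by rw [← hprod, hsum]; ring
  have hn1 := hR σ₁ hq1
  have hn2 := hR σ₂ hq2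
  set W : ℕ → ℂ := fun n => (w n : ℂ) with hW
  have hWrec : ∀ n, W (n + 2) = -(p : ℂ) * W (n + 1) - (κ : ℂ) * W n := by
    intro n; simp only [hW, hw n]; push_cast; ring
  set g : ℕ → ℂ := fun n => W (n + 1) - σ₁ * W n with hg
  have hgrec : ∀ n, g (n + 1) = σ₂ * g n := by
    intro n
    simp only [hg]
    rw [show n + 1 + 1 = n + 2 by omega, hWrec n, hsum]
    linear_combination (-(W n)) * hprod - (W n / 2) * hc
  have hgn : ∀ n, g n = σ₂ ^ n * g 0 := by
    intro n
    induction n with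
    | zero => simp
    | succ n ih => rw [hgrec, ih]; ring
  -- `‖g 0‖ ≤ |w 1| + R |w 0|`
  have hg0 : ‖g 0‖ ≤ |w 1| + R * |w 0| := by
    have e : g 0 = W 1 - σ₁ * W 0 := rfl
    rw [e]
    calc ‖W 1 - σ₁ * W 0‖ ≤ ‖W 1‖ + ‖σ₁ * W 0‖ := norm_sub_le _ _
      _ = |w 1| + ‖σ₁‖ * |w 0| := by simp only [hW, norm_mul, Complex.norm_real, Real.norm_eq_abs]
      _ ≤ |w 1| + R * |w 0| := by
          have := mul_le_mul_of_nonneg_right hn1 (abs_nonneg (w 0)); linarith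
  have hbound : ∀ n : ℕ, ‖W (n + 1)‖ ≤ R ^ (n + 1) * ‖W 0‖ + ((n : ℝ) + 1) * R ^ n * ‖g 0‖ := by
    intro n
    induction n with
    | zero =>
      have e : W (0 + 1) = σ₁ * W 0 + g 0 := by simp only [hg]; ring
      rw [e]
      simp only [zero_add, pow_one, pow_zero, Nat.cast_zero, one_mul, mul_one]
      calc ‖σ₁ * W 0 + g 0‖ ≤ ‖σ₁ * W 0‖ + ‖g 0‖ := norm_add_le _ _
        _ = ‖σ₁‖ * ‖W 0‖ + ‖g 0‖ := by rw [norm_mul]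
        _ ≤ R * ‖W 0‖ + ‖g 0‖ := by
          have h0 : 0 ≤ ‖W 0‖ := norm_nonneg _
          nlinarith
    | succ n ih =>
      have e : W (n + 1 + 1) = σ₁ * W (n + 1) + g (n + 1) := by simp only [hg]; ring
      rw [e]
      have hgnorm : ‖g (n + 1)‖ ≤ R ^ (n + 1) * ‖g 0‖ := by
        rw [hgn (n + 1), norm_mul, norm_pow]
        exact mul_le_mul_of_nonneg_right (pow_le_pow_left₀ (norm_nonneg _) hn2 _) (norm_nonneg _)
      calc ‖σ₁ * W (n + 1) + g (n + 1)‖ ≤ ‖σ₁‖ * ‖W (n + 1)‖ + ‖g (n + 1)‖ := by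
            rw [← norm_mul]; exact norm_add_le _ _
        _ ≤ R * (R ^ (n + 1) * ‖W 0‖ + (n + 1) * R ^ n * ‖g 0‖) + R ^ (n + 1) * ‖g 0‖ := by
            have h2 : 0 ≤ ‖W (n + 1)‖ := norm_nonneg _
            nlinarith [norm_nonneg σ₁]
        _ = R ^ (n + 1 + 1) * ‖W 0‖ + ((n + 1 : ℕ) + 1 : ℝ) * R ^ (n + 1) * ‖g 0‖ := by
            push_cast; ring
  have hWn : ‖W (n + 1)‖ = |w (n + 1)| := by simp only [hW, Complex.norm_real, Real.norm_eq_abs]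
  have hW0 : ‖W 0‖ = |w 0| := by simp only [hW, Complex.norm_real, Real.norm_eq_abs]
  have h := hbound n
  rw [hWn, hW0] at h
  have hpos : 0 ≤ ((n : ℝ) + 1) * R ^ n := by positivity
  calc |w (n + 1)| ≤ R ^ (n + 1) * |w 0| + ((n : ℝ) + 1) * R ^ n * ‖g 0‖ := h
    _ ≤ R ^ (n + 1) * |w 0| + ((n : ℝ) + 1) * R ^ n * (|w 1| + R * |w 0|) := by
        have := mul_le_mul_of_nonneg_left hg0 hpos; linarith

/-- The qualitative corollary: `R < 1 ⇒ w_n → 0`. [cite: Stanley2012EC1, §4.1 Theorem 4.1.1 (iii) (lane statement)] -/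
theorem tendsto_zero_of_rec_two_of_lt_one {p κ R : ℝ} (hR0 : 0 ≤ R) (hR1 : R < 1) (hR : ∀ σ : ℂ, σ ^ 2 + p * σ + κ = 0 → ‖σ‖ ≤ R)
    {w : ℕ → ℝ} (hw : ∀ n, w (n + 2) = -p * w (n + 1) - κ * w n) : Tendsto w atTop (𝓝 0) := by
  have hlim : Tendsto (fun n : ℕ => R ^ (n + 1) * |w 0| + ((n : ℝ) + 1) * R ^ n * (|w 1| + R * |w 0|)) atTop (𝓝 0) := by
    have h1 : Tendsto (fun n : ℕ => R ^ (n + 1)) atTop (𝓝 0) :=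
      (tendsto_pow_atTop_nhds_zero_of_lt_one hR0 hR1).comp (tendsto_add_atTop_nat 1)
    have h2 : Tendsto (fun n : ℕ => (n : ℝ) * R ^ n) atTop (𝓝 0) := tendsto_self_mul_const_pow_of_lt_one hR0 hR1
    have h3 : Tendsto (fun n : ℕ => R ^ n) atTop (𝓝 0) := tendsto_pow_atTop_nhds_zero_of_lt_one hR0 hR1
    have h := (h1.mul_const |w 0|).add ((h2.add h3).mul_const (|w 1| + R * |w 0|))
    simp only [zero_mul, zero_add] at h
    refine h.congr fun n => ?_
    ring
  have hW1 : Tendsto (fun n => w (n + 1)) atTop (𝓝 0) := by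
    refine squeeze_zero_norm (fun n => ?_) hlim
    rw [Real.norm_eq_abs]
    exact abs_le_of_rec_two hR0 hR hw n
  exact (tendsto_add_atTop_iff_nat 1).1 hW1

/-! ## §2 The shifted recurrence (convergence to a nonzero limit at a geometric rate) -/

/-- ★★ **Geometric convergence to the limit**: if `w_{n+2} + p w_{n+1} + κ w_n = c` for all `n`, `1 + p + κ ≠ 0`, and every root of
`σ² + pσ + κ` has modulus `≤ R`, then with `L = c/(1 + p + κ)`:
`|w_{n+1} − L| ≤ R^{n+1}|w₀ − L| + (n+1) Rⁿ (|w₁ − L| + R|w₀ − L|)` (apply §1 to `w − L`).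
[cite: Stanley2012EC1, §4.1 Theorem 4.1.1 (iii) (lane statement, explicit constants)] -/
theorem abs_sub_le_of_rec_two_shift {p κ R c : ℝ} (hR0 : 0 ≤ R) (hR : ∀ σ : ℂ, σ ^ 2 + p * σ + κ = 0 → ‖σ‖ ≤ R)
    (hden : 1 + p + κ ≠ 0) {w : ℕ → ℝ} (hw : ∀ n, w (n + 2) + p * w (n + 1) + κ * w n = c) (n : ℕ) :
    |w (n + 1) - c / (1 + p + κ)| ≤ R ^ (n + 1) * |w 0 - c / (1 + p + κ)| +
      ((n : ℝ) + 1) * R ^ n * (|w 1 - c / (1 + p + κ)| + R * |w 0 - c / (1 + p + κ)|) := by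
  set L := c / (1 + p + κ) with hL
  have hLc : L + p * L + κ * L = c := by rw [hL]; field_simp
  have hv : ∀ n, (w (n + 2) - L) = -p * (w (n + 1) - L) - κ * (w n - L) := by
    intro n; have := hw n; linarith
  exact abs_le_of_rec_two (w := fun n => w n - L) hR0 hR hv n

end Literature.Analysis
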